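import Summits.BirchSwinnertonDyer.BirchSwinnertonDyer.Theorems.TeichmullerTwistDescentKOfCarrierOnly
import Literature.NumberTheory.EllipticCurves.NewformDualSeparation
import HarnessLib

/-!
# Route `TeichmullerTwistDescent`: the twisted period-lattice saturation at EVERY additive (G)-ordinary unstarred prime
# `p ≥ 5` (Kummer corner included) from modularity and an integral tame-type carrier functional — the bottom of «K₅»

Cell `pub/bsd-wall` (D-0145 line route-BirchSwinnertonDyer-TeichmullerTwistDescent, OPEN rev 8), seat `bsd-line-ttd-p1` (prover 1/2,
g29).  THEOREMS ONLY; `--supports stmt-BirchSwinnertonDyer-24306`.  BSD is not proved by this file; no item is closed by it.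

WHAT.  The K-line (g24–g28) proved the crux K `TwistedPeriodLatticeSaturation` (`Λ(f) ⊆ g(χ)·Λ(f ⊗ χ)` for the optimal curve `W`
of conductor `p²M`, `χ` the quadratic character mod `p`) from five named published inputs under the prefix `11 ≤ p`.  The route pen's
key for this seat (EVENT88) asks for the transfer of the argument to the Kummer corner `(p, ord_pΔ) ∈ {(5, 3), (7, 2)}`.  The bottom
of the chain is already `p ≥ 5`-generic in the tree — the Gauss-sum dichotomy `index_dichotomy_of_modularity` (`5 ≤ p`), the
case-one exclusion from the carrier `CarrierMultOne.not_caseOne_of_carrier_of_multOne` (`5 ≤ p`), multiplicity one from newform theory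
(`exists_dualSeparation_of_isNewformOf`, `exists_intHeckeQuasiProjector`, `multOneHyp_of_intHeckeProjector_padicInt`, `5 ≤ p`) — only the
wrappers `CarrierDatum.saturation_at_of_carrier` … `KOfCarrierOnly` thread the binder `11 ≤ p` of K's text.  This file states the
pointwise composite with `5 ≤ p`:

* `multOneHyp_of_modularity` — `MultOneHyp ℤ_p p M hpM f_D` for the newform of a modular parametrisation datum at level `p²M`,
  `p ≥ 5` (dual separation ⟹ rational multiplicity one ⟹ integral Hecke quasi-projector);
* `saturation_at_of_integralFunctional` — for `W` of conductor `p²M`, `5 ≤ p`, additive, `E[p]` irreducible, (G)-ordinary,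
  `ord_pΔ_min ≤ 4`, `D` lattice-optimal, `χ` primitive quadratic mod `p`, and an equivariant functional
  `Ψ : Λ_Q(f_D) → coordRep(ω̃^{p−1−b}, ω̃ᵇ)` (`0 < b`, `2b < p − 1`) of finite index whose image has reduction socle
  `⊆ Sym^{2b} ⊗ det^{−b}`: `Λ(f_D) ⊆ g(χ)·Λ(f_D ⊗ χ)`.

The sequel `TeichmullerTwistDescentKFiveOfTameType` supplies `Ψ` from the type fact and the weight exclusion (W‴)₅
(`TeichmullerTwistDescentWeightExclusionFive`), giving «K₅» = K's text with `5 ≤ p` from the same five named inputs.  The corner items are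
NOT closed by this (the last step of the GE11 glue, Edixhoven 1991 Thm. 3 for the starred partner, is typed `7 < p`; seat memo
KLINE-CORNER-ttdp1g29.md).
-/

set_option autoImplicit false
-- single-conjunct summit: `Summit.BirchSwinnertonDyer.BirchSwinnertonDyer.…` repeats the name by design
set_option linter.dupNamespace false

noncomputable section

open scoped Pointwise MatrixGroups TensorProduct

open Function CongruenceSubgroup
open Literature.RepresentationTheory.FiniteGroups Literature.RepresentationTheory.FiniteGroups.GL2
  Literature.NumberTheory.EllipticCurves.ModularForms
open Literature.NumberTheory.EllipticCurves (Kato2004.teichmullerChar)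
open Literature.NumberTheory.ModularSymbols Literature.NumberTheory.ModularSymbols.FullLevel
open Literature.Algebra.Homology

namespace Summit.BirchSwinnertonDyer.BirchSwinnertonDyer.Theorems.TeichmullerTwistDescent.KFive

open WeierstrassCurve Literature.NumberTheory.EllipticCurves
  Summit.BirchSwinnertonDyer.BirchSwinnertonDyer.Theorems.TeichmullerTwistDescent.KOfIntHeckeProjector
  Summit.BirchSwinnertonDyer.BirchSwinnertonDyer.Theorems.TeichmullerTwistDescent.CarrierMultOne
  Summit.BirchSwinnertonDyer.BirchSwinnertonDyer.Theorems.TeichmullerTwistDescent.TwistedPeriodLatticeDichotomy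

variable (p M : ℕ) [hp : Fact p.Prime] [NeZero M] [NeZero (p ^ 2 * M)] (hpM : Nat.Coprime p M)
  [Fintype (diagTorus (ZMod p))] [Invertible (Fintype.card (diagTorus (ZMod p)) : ℤ_[p])]

/-- **Multiplicity one for the newform of a modular parametrisation datum at level `p²M`, `p ≥ 5`** (`MultOneHyp ℤ_p p M hpM f_D`):
dual separation for `f_D` on `S₂(Γ₀(p²M))^∨` (Atkin–Lehner + strong multiplicity one, `exists_dualSeparation_of_isNewformOf`) ⟹
rational multiplicity one on `H₁(X₀(p²M), ℚ)` (`eq_zero_of_dualSeparation_T`) ⟹ an integral Hecke quasi-projector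
(`exists_intHeckeQuasiProjector`) ⟹ `MultOneHyp` (`multOneHyp_of_intHeckeProjector_padicInt`, `12 ∈ ℤ_pˣ`).
[cite: AtkinLehner1970, Thm. 4 and Thm. 5] [cite: Shimura1971, Thm. 3.41 and Thm. 3.51] -/
theorem multOneHyp_of_modularity (hp5 : 5 ≤ p) (W : WeierstrassCurve ℚ) [W.IsElliptic] [W.IsGloballyMinimal]
    (D : ModularParametrizationData W (p ^ 2 * M)) : MultOneHyp ℤ_[p] p M hpM D.f := by
  obtain ⟨s, a, hT, hsep⟩ := exists_dualSeparation_of_isNewformOf W D.isNewformOf p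
  have hMO : ∀ v : CuspidalHomologyHeckeModule (p ^ 2 * M) ℚ,
      (∀ i ∈ s, v ∈ Module.End.maxGenEigenspace (heckeOp (p ^ 2 * M) ℚ i.1 i.2.1) (a i : ℚ)) →
        periodClassK (p ^ 2 * M) ℚ D.f v = 0 → v = 0 :=
    fun v hv hφ => eq_zero_of_dualSeparation_T (p ^ 2 * M) D.f s (fun i => i.1) (fun i => i.2.1) a hsep v hv hφ
  obtain ⟨θ₀, c, hθ₀, hc, hkill₀, hscale₀⟩ :=
    exists_intHeckeQuasiProjector (p ^ 2 * M) p D.f s (fun i => i.1) (fun i => i.2.1) (fun i => i.2.2) a hT hMO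
  exact multOneHyp_of_intHeckeProjector_padicInt p M hpM hp5 D.f hθ₀ hc hkill₀ hscale₀

/-- **The twisted period-lattice saturation at `(W, p, D, χ)`, `p ≥ 5`, from modularity and an integral tame-type carrier
functional** (`CarrierMultOne.saturation_at_of_carrier_of_multOne` with `11 ≤ p` weakened to `5 ≤ p` and multiplicity one discharged):
for `W` of conductor `p²M`, additive, (G)-ordinary with `ord_pΔ_min ≤ 4`, `E[p]` irreducible, `D` lattice-optimal at level `p²M`, `χ`
primitive quadratic mod `p`, and an equivariant `Ψ : Λ_Q(f_D) → coordRep(ω̃^{p−1−b}, ω̃ᵇ)` (`0 < b`, `2b < p − 1`) of finite index with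
reduction socle `⊆ Sym^{2b} ⊗ det^{−b}`: `Λ(f_D) ⊆ g(χ)·Λ(f_D ⊗ χ)`.  Proof: the dichotomy `index_dichotomy_of_modularity` (`5 ≤ p`,
`0 ≤ ord_p j` from (G)-ordinarity, `ord_pΔ < 6`) leaves this or «case one», excluded by `not_caseOne_of_carrier_of_multOne`.
The Kummer corner `(5, III)`, `(7, II)` and the cell `(7, IV)` are instances.  BSD is not proved by this.
[cite: EdixhovenManin1991, §4] [cite: EmertonGeeSavitt2015, Lemma 4.1.1] [cite: Stevens1989, Lemma (5.4) p. 97] -/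
theorem saturation_at_of_integralFunctional (hnf : exists_isNewformOf) (hp5 : 5 ≤ p)
    (W : WeierstrassCurve ℚ) [W.IsElliptic] [W.IsGloballyMinimal]
    (hN : W.conductorNorm ℤ = p ^ 2 * M) (D : ModularParametrizationData W (p ^ 2 * M))
    (hadd : Rank1Residual.Addv W p) (hirr : Rank1Residual.Irr W p)
    (hGo : Summit.BirchSwinnertonDyer.Rank1Residual.Additive.TypeGOrd W p)
    (hV4 : padicValInt p W.minimalDiscriminantInt ≤ 4)
    (hopt : ∀ z ∈ D.L.lattice, ∃ w ∈ periodLattice D.f, z = D.c * w)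
    (χ : DirichletCharacter ℂ p) (hχ : χ.IsQuadratic) (hprim : χ.IsPrimitive)
    {k : Type} [Field k] [CharP k p] [Algebra ℤ_[p] k] [Finite k]
    (hsurj : Surjective (algebraMap ℤ_[p] k))
    (halg : ∀ x : ℤ_[p], algebraMap ℤ_[p] k x = ZMod.castHom (dvd_refl p) k (PadicInt.toZMod x))
    {b : ℕ} (hb : 0 < b) (hb2 : 2 * b < p - 1)
    (Ψ : spreadLattice ℤ_[p] p M hpM D.f →ₗ[ℤ_[p]] (Option (ZMod p) → ℤ_[p]))
    (hΨ : IsEquivariantOnSpread ℤ_[p] p M hpM D.f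
      (coordRep (Kato2004.teichmullerChar p ^ (p - 1 - b)) (Kato2004.teichmullerChar p ^ b)) Ψ)
    {m : ℕ} (hm : ∀ v : Option (ZMod p) → ℤ_[p], (p : ℤ_[p]) ^ m • v ∈ LinearMap.range Ψ)
    (hsoc : ∀ Λ' : Subrepresentation (coordRep (Kato2004.teichmullerChar p ^ (p - 1 - b)) (Kato2004.teichmullerChar p ^ b)),
      Λ'.toSubmodule = LinearMap.range Ψ →
        ReductionSocleLe p k (Kato2004.teichmullerChar p ^ (p - 1 - b)) (Kato2004.teichmullerChar p ^ b) (2 * b) Λ') :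
    ∀ z ∈ periodLattice D.f, ∃ w ∈ periodLattice (charTwist (p ^ 2 * M) (dvd_refl _) (dvd_mul_right (p ^ 2) M) hχ D.f),
      z = gaussSum χ (ZMod.stdAddChar (N := p)) * w := by
  -- the dichotomy at conductor level, transported to level `p²M` along `hN`
  have hdich : ∀ (N : ℕ) (hNN : W.conductorNorm ℤ = N) [NeZero N] (D' : ModularParametrizationData W N)
      (hsq : p ^ 2 ∣ N), (∀ z ∈ D'.L.lattice, ∃ w ∈ periodLattice D'.f, z = D'.c * w) →
      (∀ z ∈ periodLattice D'.f, ∃ w ∈ periodLattice (charTwist N (dvd_refl _) hsq hχ D'.f),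
          z = gaussSum χ (ZMod.stdAddChar (N := p)) * w) ∨
      (∀ w ∈ periodLattice (charTwist N (dvd_refl _) hsq hχ D'.f),
          ∃ z ∈ periodLattice D'.f, gaussSum χ (ZMod.stdAddChar (N := p)) * w = (p : ℂ) * z) := by
    intro N hNN
    subst hNN
    intro _ D' hsq hopt'
    exact index_dichotomy_of_modularity hnf W p D' hsq hp5 hadd hirr
      (Summit.BirchSwinnertonDyer.Rank1Residual.Additive.padicValRat_j_nonneg_of_typeGOrd W p hGo) (by omega) hopt' χ hχ hprim
  rcases hdich (p ^ 2 * M) hN D (dvd_mul_right (p ^ 2) M) hopt with h | hcase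
  · exact h
  · exact (not_caseOne_of_carrier_of_multOne p M hpM hp5 hsurj halg D.f hb hb2 hχ hprim Ψ hΨ hm hsoc
      (multOneHyp_of_modularity p M hpM hp5 W D) hcase).elim

end Summit.BirchSwinnertonDyer.BirchSwinnertonDyer.Theorems.TeichmullerTwistDescent.KFive
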